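import Mathlib
import HarnessLib
import Summits.HubbardSuperconductivity.HubbardSuperconductivity.Theorems.KLProgrammeKLRegimeSplitThermalLayer
import Summits.HubbardSuperconductivity.HubbardSuperconductivity.Theorems.KLProgrammeKLRegimeSplitLegStaging

/-!
# Route `KLProgramme` — crux K3 split, ENGINE child `KLRegimeEngineV7` (stmt-HubbardSuperconductivity-19662): the KINEMATICS of the
# (D) leg-dressing term — support of one slice of Salmhofer's cutoff at the reading frequency, the temperature-aware crossing count
# `legSliceCountT`, its sums, and the bridge «dressed ⇒ counted» (cell gate-hubbard-kl, seat hubbard-kl-k3c2-p3, finding Δ16)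

WHAT THE (D) TERM IS (p1b (D), p1 `…SplitEngineV4` / Δ15 `…SplitLegStaging`).  One engine step `n − 1 → n` integrates the slice
covariance `g_n = C^K_{>Λ_n} − C^K_{>Λ_{n−1}}` (`hubbardCovSliceCT`, semigroup of `effAction`); among the connected amputated graphs with ONE
`g_n`-line and four external legs is the one-particle-REDUCIBLE tree «quartic kernel of `𝒱_{n−1}` —`g_n(ℓ)`— two-leg kernel of `𝒱_{n−1}`»
on an external leg `ℓ`: at fixed external momenta it contributes `ζ_n(ℓ)·λ_{n−1}`, `ζ_n(ℓ) = g_n(±ω₀,ℓ)·W₂^{(n−1)}(±ω₀,ℓ)`, to the value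
increments bounded in (E2-v5)/(E2″-v5)/(E2′-S2) by `… + legDressBarQ G P Q U n (#crossing legs)`.  At the reading frequency
`ω₀ = π/β` (`matsubaraFreq_omega0`) the slice weight of the leg is `χ₂(t²/Λ_n²) − χ₂(t²/Λ²_{n−1})` with
`t(ℓ)² = ω₀² + e_K(ℓ)²` (`hubbardCutoffWeightCT`, `salmhoferCutoff`: `0` on `[0, ¼]`, `1` on `[1, ∞)`), and the propagator modulus is `1/t(ℓ)`.

FINDING Δ16 (this seat, HOME/STATUS 2026-08-26 ≈16:3xZ, HOME/hubbard-kl-k3c2-p3/DELTA16-NOTE.md).  The slice weight is nonzero only for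
`Λ_n/2 < t(ℓ) < Λ_{n−1}` (`klld_slice_support`) — a window in `t`, NOT in `|e_K|`.  For `n ≤ n_β − 1` (`ω₀ ≤ Λ_n/4`) this lies inside
p1's `legSliceCount` window `Λ_{n+2} ≤ |e_K| ≤ Λ_{n−2}`; at the thermal end `n ∈ {n_β, n_β+1}` (`ω₀ > Λ_{n+1}`) legs with `|e_K(ℓ)| < Λ_{n+2}`
— e.g. ON the frame's Fermi curve — are dressed but not counted, and their residual-local-part dressing `≤ 64·cr·|U|·4^{−n}` is `R`-level
(`RenormalisedAtF`), which no `G/P`-level term of the clause (`thermalBar`, `gainBar`, `eremBar`'s quadratic part) can carry for every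
`R` (order `∃G ∀P ∀R ∃Q`).  REPAIR (R-a), typed here: count in the variable the cutoff reads,
`legSliceCountT L β μ K n k := #{i : Λ_{n+2} ≤ √((π/β)² + e_K(k_i)²) ≤ Λ_{n−2}}`.  Then EVERY dressed leg is counted at EVERY scale
(`klld_counted_of_weight_ne`), the ladder sum is still `≤ 20` (`legSliceCountT_sum_le`, p1's `card_scales_in_window_le` verbatim), and on
the support `1/t < 2/Λ_n` (`klld_inv_lt_of_slice_support`), so the residual dressing per counted leg is `≤ 32·cr·|U|·4^{−n}`
(`klld_residual_dressing_arith`) — `legDressBarQ`'s quadratic profile with `Q.CR ≥ 32·cr/Klam`.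

CONTENTS (pure real analysis + finite bookkeeping; nothing about the model is asserted): §1 slice support of `salmhoferCutoff` between two
scales and its KL-scale corollaries; §2 `klLegRadius`, `legSliceCountT`, `≤ 4`, `Σ_{n ≤ N} ≤ 20`, `legDressBarQ` monotone in the count;
§3 the bridge from the model's cutoff weights `hubbardCutoffWeightCT … (klScale klE0 n) (omega0 M, ℓ)` (and at `(omega0 M).rev`),
§3b the same read on the slice covariance `hubbardCovSliceCT` (a nonzero entry has a leg whose weight changes); §4 the abstract dressing-sum bound `‖Σ_i ζ_i‖ ≤ z · #{i counted}` an engine proof instantiates with `z = ` its per-leg bound.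
References: BGM 2006 [arXiv:cond-mat/0507686] §2.3 (2.27)–(2.31), (2.38); M. Salmhofer, *Renormalization* (1999) §4.2.5 (4.70);
HOME/p1/CHILD1-SKELETON.md §6 (Δ15); `…SplitEngineV4` (p444106), `…SplitEngineV4Sums` (p444942), `…SplitLegStaging` (p450191),
`…SplitThermalLayer` (p454158).
-/

noncomputable section

namespace Summit.HubbardSuperconductivity.HubbardSuperconductivity.Theorems.KLRegimeSplit

set_option linter.dupNamespace false -- summit = problem name (single-conjunct summit), D-0017

open Real Finset Literature.MathematicalPhysics.QuantumLattice Literature.Probability.LatticeModels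
open Summit.HubbardSuperconductivity.HubbardSuperconductivity.Theorems.KLProgrammeLegKernels

/-! ## §1 Support of one slice of Salmhofer's cutoff -/

/-- Below both thresholds both weights vanish: `r ≤ Λ²/4`, `Λ ≤ Λ'` ⇒ `χ₂(r/Λ²) = χ₂(r/Λ'²) = 0`. -/
theorem klld_weights_eq_zero_of_le {r Λ Λ' : ℝ} (hΛ : 0 < Λ) (hΛΛ' : Λ ≤ Λ') (hr : 0 ≤ r) (h : r ≤ Λ ^ 2 / 4) :
    salmhoferCutoff (r / Λ ^ 2) = 0 ∧ salmhoferCutoff (r / Λ' ^ 2) = 0 := by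
  have hΛ2 : 0 < Λ ^ 2 := by positivity
  have hΛ'2 : 0 < Λ' ^ 2 := by have : 0 < Λ' := hΛ.trans_le hΛΛ'; positivity
  have h1 : r / Λ ^ 2 ≤ 1 / 4 := by rw [div_le_iff₀ hΛ2]; linarith
  have hsq : Λ ^ 2 ≤ Λ' ^ 2 := pow_le_pow_left₀ hΛ.le hΛΛ' 2
  have h2 : r / Λ' ^ 2 ≤ r / Λ ^ 2 := div_le_div_of_nonneg_left hr hΛ2 hsq
  exact ⟨salmhoferCutoff_of_le h1, salmhoferCutoff_of_le (h2.trans h1)⟩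

/-- Above both thresholds both weights are one: `Λ'² ≤ r`, `Λ ≤ Λ'` ⇒ `χ₂(r/Λ²) = χ₂(r/Λ'²) = 1`. -/
theorem klld_weights_eq_one_of_ge {r Λ Λ' : ℝ} (hΛ : 0 < Λ) (hΛΛ' : Λ ≤ Λ') (h : Λ' ^ 2 ≤ r) :
    salmhoferCutoff (r / Λ ^ 2) = 1 ∧ salmhoferCutoff (r / Λ' ^ 2) = 1 := by
  have hΛ2 : 0 < Λ ^ 2 := by positivity
  have hΛ' : 0 < Λ' := hΛ.trans_le hΛΛ'
  have hΛ'2 : 0 < Λ' ^ 2 := by positivity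
  have hr : 0 ≤ r := hΛ'2.le.trans h
  have h1 : 1 ≤ r / Λ' ^ 2 := by rw [le_div_iff₀ hΛ'2]; linarith
  have hsq : Λ ^ 2 ≤ Λ' ^ 2 := pow_le_pow_left₀ hΛ.le hΛΛ' 2
  have h2 : r / Λ' ^ 2 ≤ r / Λ ^ 2 := div_le_div_of_nonneg_left hr hΛ2 hsq
  exact ⟨salmhoferCutoff_of_ge (h1.trans h2), salmhoferCutoff_of_ge h1⟩

/-- **Slice support**: if the weights of the fields above `Λ` and above `Λ' ≥ Λ` DIFFER at squared radius `r ≥ 0`, then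
`Λ²/4 < r < Λ'²`. -/
theorem klld_slice_support {r Λ Λ' : ℝ} (hΛ : 0 < Λ) (hΛΛ' : Λ ≤ Λ') (hr : 0 ≤ r)
    (h : salmhoferCutoff (r / Λ ^ 2) ≠ salmhoferCutoff (r / Λ' ^ 2)) : Λ ^ 2 / 4 < r ∧ r < Λ' ^ 2 := by
  constructor
  · by_contra hle
    obtain ⟨h0, h0'⟩ := klld_weights_eq_zero_of_le hΛ hΛΛ' hr (not_lt.mp hle)
    exact h (h0.trans h0'.symm)
  · by_contra hle
    obtain ⟨h1, h1'⟩ := klld_weights_eq_one_of_ge hΛ hΛΛ' (not_lt.mp hle)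
    exact h (h1.trans h1'.symm)

/-- `Λ_m ≤ Λ_n` for `n ≤ m` (the KL scales decrease along the ladder). -/
theorem klld_klScale_anti {n m : ℕ} (h : n ≤ m) : klScale klE0 m ≤ klScale klE0 n := by
  have hq := klth_klScale_div_klScale h
  have hpos := klth_klScale_pos n
  have h1 : ((4 : ℝ) ^ (m - n))⁻¹ ≤ 1 := inv_le_one_of_one_le₀ (one_le_pow₀ (by norm_num))
  have h2 : klScale klE0 m / klScale klE0 n ≤ 1 := hq ▸ h1
  rwa [div_le_one hpos] at h2

/-- One step UP the ladder multiplies the scale by `4`: for `1 ≤ n`, `Λ_{n-1} = 4·Λ_n`. -/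
theorem klld_klScale_pred {n : ℕ} (hn : 1 ≤ n) : klScale klE0 (n - 1) = 4 * klScale klE0 n := by
  obtain ⟨m, rfl⟩ := Nat.exists_eq_add_of_le hn
  rw [show 1 + m - 1 = m by omega, show 1 + m = m + 1 by omega, klth_klScale_succ]
  ring

/-- **Slice support between consecutive KL scales, as a window**: for `1 ≤ n`, if the weights above `Λ_n` and above `Λ_{n−1}` differ
at `r = t² ≥ 0`, then `Λ_{n+2} ≤ t ≤ Λ_{n−2}` (`t = √r`; in fact `Λ_n/2 < t < Λ_{n−1}`). -/
theorem klld_window_of_slice_ne {r : ℝ} {n : ℕ} (hn : 1 ≤ n) (hr : 0 ≤ r)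
    (h : salmhoferCutoff (r / klScale klE0 n ^ 2) ≠ salmhoferCutoff (r / klScale klE0 (n - 1) ^ 2)) :
    klScale klE0 (n + 2) ≤ Real.sqrt r ∧ Real.sqrt r ≤ klScale klE0 (n - 2) := by
  have hΛ := klth_klScale_pos n
  have hΛΛ' : klScale klE0 n ≤ klScale klE0 (n - 1) := klld_klScale_anti (Nat.sub_le n 1)
  obtain ⟨hlo, hhi⟩ := klld_slice_support hΛ hΛΛ' hr h
  constructor
  · -- `Λ_{n+2} = Λ_n/16 ≤ Λ_n/2 < √r`
    have h16 : klScale klE0 (n + 2) = klScale klE0 n / 16 := by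
      rw [show n + 2 = (n + 1) + 1 by omega, klth_klScale_succ, klth_klScale_succ]; ring
    have hhalf : klScale klE0 n / 2 < Real.sqrt r := by
      rw [show klScale klE0 n / 2 = Real.sqrt ((klScale klE0 n / 2) ^ 2) by rw [Real.sqrt_sq (by positivity)]]
      exact Real.sqrt_lt_sqrt (by positivity) (by rw [div_pow]; norm_num; linarith)
    rw [h16]
    linarith
  · -- `√r < Λ_{n-1} ≤ Λ_{n-2}`
    have h1 : Real.sqrt r < klScale klE0 (n - 1) := by
      rw [show klScale klE0 (n - 1) = Real.sqrt (klScale klE0 (n - 1) ^ 2) by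
        rw [Real.sqrt_sq (klth_klScale_pos _).le]]
      exact Real.sqrt_lt_sqrt hr hhi
    have h2 : klScale klE0 (n - 1) ≤ klScale klE0 (n - 2) := klld_klScale_anti (by omega)
    linarith

/-- **On the slice the propagator is bounded by `2/Λ_n`**: if the weights above `Λ_n` and `Λ_{n−1}` differ at `r = t²`, then
`1/√r < 2/Λ_n`. -/
theorem klld_inv_lt_of_slice_ne {r : ℝ} {n : ℕ} (hr : 0 ≤ r)
    (h : salmhoferCutoff (r / klScale klE0 n ^ 2) ≠ salmhoferCutoff (r / klScale klE0 (n - 1) ^ 2)) :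
    (Real.sqrt r)⁻¹ < 2 / klScale klE0 n := by
  have hΛ := klth_klScale_pos n
  have hΛΛ' : klScale klE0 n ≤ klScale klE0 (n - 1) := klld_klScale_anti (Nat.sub_le n 1)
  obtain ⟨hlo, -⟩ := klld_slice_support hΛ hΛΛ' hr h
  have hhalf : klScale klE0 n / 2 < Real.sqrt r := by
    rw [show klScale klE0 n / 2 = Real.sqrt ((klScale klE0 n / 2) ^ 2) by rw [Real.sqrt_sq (by positivity)]]
    exact Real.sqrt_lt_sqrt (by positivity) (by rw [div_pow]; norm_num; linarith)
  have hsq : 0 < Real.sqrt r := lt_trans (by positivity) hhalf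
  rw [inv_eq_one_div, div_lt_div_iff₀ hsq hΛ]
  linarith

/-- **Arithmetic of the residual dressing** (`n ≥ 1`): propagator bound `2/Λ_n` times the quadratic renormalisation tolerance of the
previous scale `cr·|U|·Λ²_{n−1}/e₀` (`RenormalisedAtF … (n−1)`) equals `32·cr·|U|·4^{−n}` — `legDressBarQ`'s quadratic profile. -/
theorem klld_residual_dressing_arith (cr U : ℝ) {n : ℕ} (hn : 1 ≤ n) :
    2 / klScale klE0 n * (cr * |U| * klScale klE0 (n - 1) ^ 2 / klE0) = 32 * cr * |U| * ((4 : ℝ) ^ n)⁻¹ := by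
  rw [klld_klScale_pred hn]
  have he : (0 : ℝ) < klE0 := by norm_num [klE0]
  have h4 : (0 : ℝ) < (4 : ℝ) ^ n := by positivity
  simp only [klScale]
  field_simp
  ring

/-! ## §2 The temperature-aware crossing count -/

section Model

variable (L M : ℕ) [NeZero L] [NeZero M]

omit [NeZero L] in
/-- **The reading radius of a leg**: `t(k⃗) = √((π/β)² + e_K(k⃗)²)` — the quantity Salmhofer's cutoff compares with `Λ²` at the
lowest Matsubara frequency. -/
def klLegRadius (β μ : ℝ) (K : TrigPolyC4v) (k : TorusSite 2 L) : ℝ :=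
  Real.sqrt ((Real.pi / β) ^ 2 + nambuXiCT L μ K k ^ 2)

omit [NeZero L] in
/-- **The number of external legs crossing slice `n`, temperature-aware** (repair (R-a) of Δ16): legs `i` whose reading radius
`t(k_i) = √((π/β)² + e_K(k_i)²)` lies in `[Λ_{n+2}, Λ_{n−2}]` (p1's window, read in `t` instead of `|e_K|`; each leg crosses at most
five slices as `n` runs, and EVERY leg whose slice-`n` weight at `±ω₀` is nonzero is counted, §3). -/
def legSliceCountT (β μ : ℝ) (K : TrigPolyC4v) (n : ℕ) (k : Fin 4 → TorusSite 2 L) : ℕ :=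
  (Finset.univ.filter fun i : Fin 4 =>
      klScale klE0 (n + 2) ≤ klLegRadius L β μ K (k i) ∧ klLegRadius L β μ K (k i) ≤ klScale klE0 (n - 2)).card

omit [NeZero L] in
/-- At most four legs cross any slice. -/
theorem legSliceCountT_le_four (β μ : ℝ) (K : TrigPolyC4v) (n : ℕ) (k : Fin 4 → TorusSite 2 L) :
    legSliceCountT L β μ K n k ≤ 4 :=
  (Finset.card_filter_le _ _).trans (by simp)

omit [NeZero L] in
/-- **(D) summed, temperature-aware count**: along the ladder a momentum configuration's four legs meet at most `20` slice windows
(the reading radius of each leg is fixed; p1's `card_scales_in_window_le`). -/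
theorem legSliceCountT_sum_le (β μ : ℝ) (K : TrigPolyC4v) (k : Fin 4 → TorusSite 2 L) (N : ℕ) :
    ∑ n ∈ range (N + 1), legSliceCountT L β μ K n k ≤ 20 := by
  simp only [legSliceCountT, Finset.card_filter]
  rw [Finset.sum_comm]
  refine (sum_le_sum (g := fun _ : Fin 4 => 5) fun i _ => ?_).trans (by simp)
  rw [← Finset.card_filter]
  exact card_scales_in_window_le (klLegRadius L β μ K (k i)) N

omit [NeZero L] in
/-- **(D) summed, `Q`-staged real form** on the extended ladder: `Σ_{n ≤ N} legDressBarQ G P Q U n (legSliceCountT … n k) ≤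
20·Q.CR·((Klam U)² + (Klam|U|)³)` (the quadratic profile `4^{-n} ≤ 1` is not exploited here). -/
theorem legDressBarQ_countT_sum_le (G : GeoConsts) {P : SplitConsts} {Q : EngConsts} (hK : 0 ≤ P.Klam) (hQ : 0 ≤ Q.CR)
    (U β μ : ℝ) (K : TrigPolyC4v) (k : Fin 4 → TorusSite 2 L) (N : ℕ) :
    ∑ n ∈ range (N + 1), legDressBarQ G P Q U n (legSliceCountT L β μ K n k) ≤
      20 * (Q.CR * ((P.Klam * U) ^ 2 + (P.Klam * |U|) ^ 3)) := by
  have hcub : 0 ≤ (P.Klam * |U|) ^ 3 := pow_nonneg (mul_nonneg hK (abs_nonneg U)) 3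
  have hstep : ∀ n ∈ range (N + 1), legDressBarQ G P Q U n (legSliceCountT L β μ K n k) ≤
      Q.CR * ((P.Klam * U) ^ 2 + (P.Klam * |U|) ^ 3) * (legSliceCountT L β μ K n k : ℝ) := by
    intro n _
    unfold legDressBarQ
    refine mul_le_mul_of_nonneg_right (mul_le_mul_of_nonneg_left ?_ hQ) (Nat.cast_nonneg _)
    have h4 : ((4 : ℝ) ^ n)⁻¹ ≤ 1 := inv_le_one_of_one_le₀ (one_le_pow₀ (by norm_num))
    have hsq : 0 ≤ (P.Klam * U) ^ 2 := sq_nonneg _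
    nlinarith
  refine (sum_le_sum hstep).trans ?_
  rw [← Finset.mul_sum, mul_comm (20 : ℝ)]
  refine mul_le_mul_of_nonneg_left ?_ (mul_nonneg hQ (add_nonneg (sq_nonneg _) hcub))
  exact_mod_cast legSliceCountT_sum_le L β μ K k N

/-- `legDressBarQ` is monotone in the count (for `Q.CR, Klam ≥ 0`): a prover who bounds the dressing by FEWER legs than counted is covered. -/
theorem legDressBarQ_mono_count (G : GeoConsts) {P : SplitConsts} {Q : EngConsts} (hK : 0 ≤ P.Klam) (hQ : 0 ≤ Q.CR) (U : ℝ)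
    (n : ℕ) {c c' : ℕ} (h : c ≤ c') : legDressBarQ G P Q U n c ≤ legDressBarQ G P Q U n c' := by
  unfold legDressBarQ
  have hcub : 0 ≤ (P.Klam * |U|) ^ 3 := pow_nonneg (mul_nonneg hK (abs_nonneg U)) 3
  have h1 : 0 ≤ Q.CR * ((P.Klam * U) ^ 2 * ((4 : ℝ) ^ n)⁻¹ + (P.Klam * |U|) ^ 3) :=
    mul_nonneg hQ (add_nonneg (by positivity) hcub)
  exact mul_le_mul_of_nonneg_left (by exact_mod_cast h) h1

/-! ## §3 The bridge: a leg whose slice weight at the reading frequency is nonzero is counted -/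

omit [NeZero L] in
/-- The model's cutoff weight above `Λ` at the lowest Matsubara frequency is Salmhofer's `χ₂(t(k⃗)²/Λ²)`. -/
theorem klld_weight_omega0 (β μ : ℝ) (K : TrigPolyC4v) (Λ : ℝ) (k : TorusSite 2 L) :
    hubbardCutoffWeightCT L M β μ K Λ (omega0 M, k) = salmhoferCutoff (klLegRadius L β μ K k ^ 2 / Λ ^ 2) := by
  rw [hubbardCutoffWeightCT, matsubaraFreq_omega0, klLegRadius, Real.sq_sqrt (by positivity)]

omit [NeZero L] in
/-- The same at the opposite frequency `−ω₀`. -/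
theorem klld_weight_omega0_rev (β μ : ℝ) (K : TrigPolyC4v) (Λ : ℝ) (k : TorusSite 2 L) :
    hubbardCutoffWeightCT L M β μ K Λ ((omega0 M).rev, k) = salmhoferCutoff (klLegRadius L β μ K k ^ 2 / Λ ^ 2) := by
  rw [hubbardCutoffWeightCT, matsubaraFreq_omega0_rev, klLegRadius, neg_sq, Real.sq_sqrt (by positivity)]

omit [NeZero L] in
/-- **Dressed ⇒ counted** (the point of the repair): at a scale `n ≥ 1`, if the weights of the fields above `Λ_n` and above `Λ_{n−1}` differ
at the leg `(ω₀, k_i)` — i.e. the slice-`n` covariance does not vanish on that leg — then leg `i` lies in the window of `legSliceCountT … n`. -/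
theorem klld_counted_of_weight_ne (β μ : ℝ) (K : TrigPolyC4v) {n : ℕ} (hn : 1 ≤ n) (k : Fin 4 → TorusSite 2 L) (i : Fin 4)
    (h : hubbardCutoffWeightCT L M β μ K (klScale klE0 n) (omega0 M, k i) ≠
      hubbardCutoffWeightCT L M β μ K (klScale klE0 (n - 1)) (omega0 M, k i)) :
    klScale klE0 (n + 2) ≤ klLegRadius L β μ K (k i) ∧ klLegRadius L β μ K (k i) ≤ klScale klE0 (n - 2) := by
  rw [klld_weight_omega0, klld_weight_omega0] at h
  have h0 : 0 ≤ klLegRadius L β μ K (k i) := Real.sqrt_nonneg _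
  have := klld_window_of_slice_ne hn (sq_nonneg _) h
  rwa [Real.sqrt_sq h0] at this

omit [NeZero L] in
/-- **Dressed ⇒ counted, counting form**: the legs whose slice-`n` weight at `ω₀` is nonzero are a subset of the counted ones, so their
number is at most `legSliceCountT … n k`. -/
theorem klld_card_dressed_le_countT (β μ : ℝ) (K : TrigPolyC4v) {n : ℕ} (hn : 1 ≤ n) (k : Fin 4 → TorusSite 2 L) :
    (Finset.univ.filter fun i : Fin 4 =>
        hubbardCutoffWeightCT L M β μ K (klScale klE0 n) (omega0 M, k i) ≠
          hubbardCutoffWeightCT L M β μ K (klScale klE0 (n - 1)) (omega0 M, k i)).card ≤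
      legSliceCountT L β μ K n k := by
  unfold legSliceCountT
  exact card_le_card (fun i hi => by
    simp only [Finset.mem_filter, Finset.mem_univ, true_and] at hi ⊢
    exact klld_counted_of_weight_ne L M β μ K hn k i hi)

omit [NeZero L] in
/-- **On a dressed leg the free propagator at `±ω₀` is bounded by `2/Λ_n`**: `1/t(k_i) < 2/Λ_n`. -/
theorem klld_inv_radius_lt_of_weight_ne (β μ : ℝ) (K : TrigPolyC4v) (n : ℕ) (k : TorusSite 2 L)
    (h : hubbardCutoffWeightCT L M β μ K (klScale klE0 n) (omega0 M, k) ≠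
      hubbardCutoffWeightCT L M β μ K (klScale klE0 (n - 1)) (omega0 M, k)) :
    (klLegRadius L β μ K k)⁻¹ < 2 / klScale klE0 n := by
  rw [klld_weight_omega0, klld_weight_omega0] at h
  have h0 : 0 ≤ klLegRadius L β μ K k := Real.sqrt_nonneg _
  have := klld_inv_lt_of_slice_ne (sq_nonneg _) h
  rwa [Real.sqrt_sq h0] at this

/-! ### §3b The same on the slice covariance the expansion integrates -/

omit [NeZero L] [NeZero M] in
/-- **An entry of the slice covariance `C^K_{>Λ} − C^K_{>Λ'}` vanishes when the cutoff weights of BOTH its field indices agree at `Λ`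
and `Λ'`** (the slice is `½(w_Λ(k_X) + w_Λ(k_Y))·C^K(X,Y) − ½(w_{Λ'}(k_X) + w_{Λ'}(k_Y))·C^K(X,Y)`, `hubbardCovAboveCT`). -/
theorem klld_covSliceCT_apply_eq_zero (β μ h : ℝ) (K : TrigPolyC4v) (Λ Λ' : ℝ) (X Y : HubbardFieldIdx L M)
    (hX : hubbardCutoffWeightCT L M β μ K Λ (momentumOf L M X) = hubbardCutoffWeightCT L M β μ K Λ' (momentumOf L M X))
    (hY : hubbardCutoffWeightCT L M β μ K Λ (momentumOf L M Y) = hubbardCutoffWeightCT L M β μ K Λ' (momentumOf L M Y)) :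
    hubbardCovSliceCT L M β μ h K Λ Λ' X Y = 0 := by
  simp only [hubbardCovSliceCT, hubbardCovAboveCT, Matrix.sub_apply, Matrix.of_apply, hX, hY, sub_self]

omit [NeZero L] [NeZero M] in
/-- Contrapositive: **a nonzero slice entry has a field index whose cutoff weight changes between the two scales** — combined with
`klld_counted_of_weight_ne`, every external leg through which the slice-`n` covariance propagates at `±ω₀` is counted by `legSliceCountT … n`. -/
theorem klld_weight_ne_of_covSliceCT_apply_ne (β μ h : ℝ) (K : TrigPolyC4v) (Λ Λ' : ℝ) (X Y : HubbardFieldIdx L M)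
    (hne : hubbardCovSliceCT L M β μ h K Λ Λ' X Y ≠ 0) :
    hubbardCutoffWeightCT L M β μ K Λ (momentumOf L M X) ≠ hubbardCutoffWeightCT L M β μ K Λ' (momentumOf L M X) ∨
      hubbardCutoffWeightCT L M β μ K Λ (momentumOf L M Y) ≠ hubbardCutoffWeightCT L M β μ K Λ' (momentumOf L M Y) := by
  by_contra hcon
  simp only [not_or, not_ne_iff] at hcon
  exact hne (klld_covSliceCT_apply_eq_zero L M β μ h K Λ Λ' X Y hcon.1 hcon.2)

end Model

/-! ## §4 The abstract dressing-sum bound -/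

/-- **Sum of per-leg dressing factors**: if `ζ_i = 0` off a set of counted legs and `‖ζ_i‖ ≤ z` on it, then `‖Σ_i ζ_i‖ ≤ z·#counted`. -/
theorem klld_norm_sum_le_mul_card {ι : Type*} [Fintype ι] (ζ : ι → ℂ) (p : ι → Prop) [DecidablePred p] {z : ℝ}
    (h0 : ∀ i, ¬p i → ζ i = 0) (hb : ∀ i, p i → ‖ζ i‖ ≤ z) :
    ‖∑ i, ζ i‖ ≤ z * ((Finset.univ.filter p).card : ℝ) := by
  classical
  have hsplit : ∑ i, ζ i = ∑ i ∈ Finset.univ.filter p, ζ i := by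
    rw [← Finset.sum_filter_add_sum_filter_not Finset.univ p]
    have : ∑ i ∈ Finset.univ.filter (fun i => ¬p i), ζ i = 0 :=
      Finset.sum_eq_zero fun i hi => h0 i (Finset.mem_filter.mp hi).2
    rw [this, add_zero]
  rw [hsplit]
  refine (norm_sum_le _ _).trans ?_
  have : ∑ i ∈ Finset.univ.filter p, ‖ζ i‖ ≤ ∑ _i ∈ Finset.univ.filter p, z :=
    Finset.sum_le_sum fun i hi => hb i (Finset.mem_filter.mp hi).2
  refine this.trans ?_
  rw [Finset.sum_const, nsmul_eq_mul, mul_comm]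

/-- The same with a LARGER count (what the clause's right-hand side carries): `‖Σ_i ζ_i‖ ≤ z·c` whenever `#counted ≤ c` and `0 ≤ z`. -/
theorem klld_norm_sum_le_mul_of_card_le {ι : Type*} [Fintype ι] (ζ : ι → ℂ) (p : ι → Prop) [DecidablePred p] {z : ℝ}
    (hz : 0 ≤ z) (h0 : ∀ i, ¬p i → ζ i = 0) (hb : ∀ i, p i → ‖ζ i‖ ≤ z) {c : ℕ} (hc : (Finset.univ.filter p).card ≤ c) :
    ‖∑ i, ζ i‖ ≤ z * (c : ℝ) :=
  (klld_norm_sum_le_mul_card ζ p h0 hb).trans (mul_le_mul_of_nonneg_left (by exact_mod_cast hc) hz)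

end Summit.HubbardSuperconductivity.HubbardSuperconductivity.Theorems.KLRegimeSplit

end
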